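import Literature.MathematicalPhysics.QuantumFieldTheory.Balaban1983to89.Node00.Record12LiveSelectorTorus
import Literature.MathematicalPhysics.QuantumFieldTheory.Balaban1983to89.Node00.Record12ContTResidue

/-!
# NODE 00 (YM-PLAN Track A) — STAGE 12, THE NUMERICS OF THE FAMILY AND THE RE-PINNED WITNESS `θ₀ᶠᵃᵐ(ε₀)` ∕ `θ₀ᶠᵃᵐ,ˡⁱᵛᵉ(ε₀)`: the (I.1.18) rate RE-PINNED
# `κ := 2·10⁴` (the (D4) wall's Kotecký–Preiss numerals hold), the small-field threshold `ε₀` an OPEN LETTER of the witness (row N2: its inequality is stated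
# by the Record13 pen and seat K0e BEFORE a value is pinned — director-ym LINE №126), the far-field candidate `eps0Far L N = 1 ∕ (32·N·(L²+1))` with its guard,
# and the located fact that NO closed `ε₀` meets the far-field guard for every family; every Stage-12 face of the witness of record re-keyed BY NAME

Cell `pub-ymgap`, seat `pub-ymgap-node00-def-K0a` (g3; K0′ COMPONENTS rows G1 numerics ∕ D1 witness; gate rows N1 ∕ N2 ∕ G of dag-lead's
`RECORD13-CLOSABILITY-GATE.md`).  [I] = [Balaban1987RG1], [III] = [Balaban1988Convergent], [IV] = [Balaban1989LargeFieldI], [B7] = [Balaban1985Averaging].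
Director-ym LINE №125 (1) «the witness re-pin of the numerics (ε₀ `FarGuard`-small, κ large)» and LINE №126 ROW N2 «state the ε₀ inequality and its consumer decl
BEFORE any value is pinned … do not pin for a dead consumer».

WHY.  The K0′ witness of record `θ₀ˡⁱᵛᵉ = theta12LiveOfRecord F N ζ Rz Zt` (`Node00/Record12LiveSelector`) carries the CLOSED numerals `numerics7OfRecord₁₂`
(`ε₀ := 1`) and `lfConstsOfRecord₁₂` (`κ := 1`) of `Node00/Record12Numerics`.  Two located demands on these numerals are on the bus.  (κ — LIVE consumer) the
(D4) wall's N1 `CondsL` at def-B13's letters of record reads `128·log 162 ≤ κ` and `10·(64·log 162 + 1) ≤ (½(ℓ₆+1) − 1)·κ`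
(`Thm/BalabanUVNodesN26AtRecord12B13Family` §Located), false at `κ = 1`: RE-PINNED HERE, `lfConstsOfFamily.κ := 2·10⁴` (`log 162 < 6`; both numerals hold with room
at the dictionary's `ℓ₆ = 2`).  (ε₀ — consumer NOT YET STATED) seat K0e's far-field guard `FarGuard N ν (F.P K) := 0 ≤ ε₀ ∧ (((d+2)·L)²∕4)·ε₀ < δ_N`,
`δ_N = min(1∕3, π∕N)` (`Node00/Record12ContTResidue`) serves the EVERYWHERE β-version proviso's annulus∕far split (`hasContTransportAlong_iff_dom_and_annulus`),
which the successor record DROPS (№125 (1) on-domain re-point; №126 C4: the (2.9) species), while the (2.9) hierarchy lemma (K0e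
`mem_domAltOfRecord_of_chiFix29All_eq_one`) wants a LOWER bound `δ + 4ε₁ ≤ ε₀` on its own free letters — so, per №126, `ε₀` is NOT pinned here: it is an
ARGUMENT of the witness (`numerics7OfFamily ε₀`, `theta12OfFamily F N ε₀ ζ Rz Zt`), admissibility reads `0 < ε₀` only, and the final value is ONE `def` once the
Record13 pen and K0e name the inequality.  LOCATED HERE (K0a g3, LOCATED-L, kernel form `exists_family_not_farGuard`): the far-field guard is read at
`P := F.P K` whose block size IS THE FAMILY'S (`(F.P K).L = F.L`, `T4Family.P_L`) and `T4Family.L` ranges over ALL odd `L > 11` ([I] p. 251) — K0′ quantifies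
over every family — so at `d = 4` the guard is `9·F.L²·ε₀ < min(1∕3, π∕N)` and NO closed `ε₀ > 0` meets it for every family; IF a surviving consumer wants it, the
value must READ THE FAMILY, e.g. the candidate `eps0Far L N := 1 ∕ (32·N·(L²+1))` (`farGuard_numerics7OfFamily_of_le`: every `0 ≤ ε₀ ≤ eps0Far F.L N` meets the
guard on every torus of `F`).  The witness is assembled by `Record12Numerics`' GENERIC maker `stage12OfNumerics` and re-pinned to the live selector by
`Record12LiveSelector`'s generic `Stage12Params.liveRepin`; it is a `Stage12Params F N` — the parameter type def-T's successor record `Record13` REUSES — so the ₁₂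
faces below re-key by name and the ₁₃ faces are a successor file once `Record13` lands.

WHAT THIS FILE PROVIDES.
* §1 `lfConstsOfFamily` (`κ := 2·10⁴`), `sect2NumericsOfFamily`, `log_162_lt_six`, **`kp_tree_lfConstsOfFamily`**, **`kp_large_lfConstsOfFamily`** (row N1's two
  numerals); `numerics7OfFamily ε₀`, `stage12NumericsOfFamily ε₀` + `rfl` views, `stage12NumericsOfFamily_pos (hε : 0 < ε₀)`; the far-field candidate `eps0Far L N`,
  **`farGuard_numerics7OfFamily_of_le`** ∕ `farGuard_numerics7OfFamily_eps0Far`, and ★ **`exists_family_not_farGuard`** (no closed `ε₀` serves every family).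
* §2 THE WITNESS `theta12OfFamily F N ε₀ ζ Rz Zt` (identity selector) with its `rfl` views, `admissible_theta12OfFamily (hε)`, `hasResidualsOfRecord_theta12OfFamily`,
  `kp_tree_∕kp_large_theta12OfFamily`, `farGuard_theta12OfFamily_of_le`, `contT_theta12OfFamily_iff_dom_and_annulus` (K0e's split, applicable whenever `ε₀ ≤ eps0Far`),
  and its live re-pin `theta12LiveOfFamily F N ε₀ ζ Rz Zt` with `admissible_`, `hasResidualsOfRecord_`, `ztUnity_`, `kp_…`, **`slotsNondegenerate_theta12LiveOfFamily
  (hP : Provisos₁₀)`**, `rungA_theta12LiveOfFamily (hε) (hP)`, **`exists_k0prime_of_theta12LiveOfFamily_of_provisos₁₂ (hε) (h)`** — 19902's text for `F` VERBATIM ⟸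
  `0 < ε₀` and `Provisos₁₂` at `θ₀ᶠᵃᵐ,ˡⁱᵛᵉ(ε₀)`.

## HONEST FRAMING — what this is NOT

* Displayed numerals meeting LOCATED windows of the tree (the sign windows, the (D4) Kotecký–Preiss numerals; the far-field guard only for the displayed candidate)
  — NOT Bałaban's undetermined «sufficiently small ∕ large» constants; `ε₀` is deliberately NOT pinned (№126 row N2).
* NOTHING of Bałaban's is asserted; `Provisos₁₀` ∕ `Provisos₁₂` at the witness are HYPOTHESES where they appear (the open rows (H-U), P6, P7, P11 of the K0′
  component table); K0′ is NOT discharged; no node count moves (typed 28∕28 · discharged 5∕28).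
* One finite four-torus programme at fixed `ε = L^{−K}` — NOT the continuum limit on ℝ⁴, NOT infinite volume, NOT OS, NOT a mass gap, NOT the Clay problem.
  No `sorry`, no `axiom`, no `instance`, no `notation`.
-/

noncomputable section

open MeasureTheory
open scoped Matrix.Norms.L2Operator

namespace Literature.MathematicalPhysics.QuantumFieldTheory.Balaban1983to89.Node00

open T4Continuum
open ExpMeanLog (deltaSU)

/-! ## §1. The numerics OF THE FAMILY: `κ := 2·10⁴` (row N1), `ε₀` an open letter (row N2), the far-field candidate and its guard -/

/-- **The term constants OF THE FAMILY**: the displayed defaults of `lfConstsOfRecord₁₂` with the (I.1.18) decay rate RE-PINNED to `κ := 2·10⁴` (print: «with a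
sufficiently large constant κ»; the (D4) wall's Kotecký–Preiss numerals ask `κ ≥ 128·log 162` and `κ ≥ 20·(64·log 162 + 1) ≈ 6532` at `ℓ₆ = 2`,
N10's Lemma 1–2 rate thresholds ask `2·10⁴ ≤ κ` — `Thm/BalabanUVNodesN10AtRecord12B13Family.thresholds_of_kappa_ge`; ONE value serves both).
[cite: Balaban1987RG1, (0.25)–(0.26) p.257 and (1.18) p.263; Balaban1988Convergent, (2.28) p.259, (2.31) p.260, (2.42) p.261 (bookkeeping witness)] -/
def lfConstsOfFamily : Step.LFConsts :=
  { lfConstsOfRecord₁₂ with κ := 20000 }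

/-- The re-pinned rate (`rfl`). [cite: Balaban1987RG1, (1.18) p.263 (bookkeeping)] -/
theorem lfConstsOfFamily_κ : lfConstsOfFamily.κ = 20000 := rfl

/-- **The §2 numerics OF THE FAMILY**: `sect2NumericsOfRecord₁₂` (`O(1)LMB := 1`, `β := 1∕4`, `B = C = M := 1`, `cR := 1`) over the re-pinned term constants.
[cite: Balaban1987RG1, (1.12) p.262; Balaban1988Convergent, (2.10) p.256, (2.34)–(2.39) p.261 (bookkeeping witness)] -/
def sect2NumericsOfFamily : Sect2Numerics :=
  { sect2NumericsOfRecord₁₂ with lf := lfConstsOfFamily }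

/-- The §2 numerics of the family carry the re-pinned term constants (`rfl`). [cite: Balaban1988Convergent, (2.28) p.259 (bookkeeping)] -/
theorem sect2NumericsOfFamily_lf : sect2NumericsOfFamily.lf = lfConstsOfFamily := rfl

/-- The §2 numerics of the family meet the §2 sign conditions (the same numerals as `sect2NumericsOfRecord₁₂_pos`). [cite: Balaban1988Convergent, (2.34)–(2.39) p.261 (bookkeeping)] -/
theorem sect2NumericsOfFamily_pos : sect2NumericsOfFamily.Pos := by
  refine ⟨one_pos, ?_, ?_, ?_⟩ <;> norm_num [sect2NumericsOfFamily, sect2NumericsOfRecord₁₂]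

/-- `log 162 < 6` (`e > 2.718`, `2.718⁶ > 162`). [cite: Balaban1987RG1, (0.26) p.257 (bookkeeping numeral)] -/
theorem log_162_lt_six : Real.log 162 < 6 := by
  rw [Real.log_lt_iff_lt_exp (by norm_num)]
  have h : (2.7182818283 : ℝ) ^ 6 < Real.exp 1 ^ 6 := pow_lt_pow_left₀ Real.exp_one_gt_d9 (by norm_num) (by norm_num)
  rw [Real.exp_one_pow] at h
  have h' : (2.7182818283 : ℝ) ^ 6 < Real.exp 6 := by simpa using h
  exact lt_trans (by norm_num) h'

/-- **Row N1, the (D4) wall's `tree` numeral, holds at the term constants of the family**: `128·log 162 ≤ κ = 2·10⁴`. [cite: Balaban1987RG1, (0.25)–(0.26) p.257 («with a sufficiently large constant κ»); Balaban1988RG2Cluster, (1.26) p.8] -/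
theorem kp_tree_lfConstsOfFamily : 128 * Real.log 162 ≤ lfConstsOfFamily.κ := by
  rw [lfConstsOfFamily_κ]
  nlinarith [log_162_lt_six]

/-- **Row N1, the (D4) wall's `large` numeral (Kotecký–Preiss form at `ℓ = ½L`), holds at the term constants of the family and the dictionary's `ℓ₆ = 2`**:
`10·(64·log 162 + 1) ≤ (½(ℓ₆+1) − 1)·κ = 10⁴`. [cite: Balaban1987RG1, (0.25)–(0.26) p.257; Balaban1988RG2Cluster, p.21 (after (2.39): «κ sufficiently large»)] -/
theorem kp_large_lfConstsOfFamily :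
    10 * (64 * Real.log 162 + 1) ≤ ((((stage3OfRecord₁₂.ℓ₆ + 1 : ℕ) : ℝ)) / 2 - 1) * lfConstsOfFamily.κ := by
  rw [lfConstsOfFamily_κ]
  have hℓ : (((stage3OfRecord₁₂.ℓ₆ + 1 : ℕ) : ℝ)) = 3 := by norm_num [stage3OfRecord₁₂]
  rw [hℓ]
  nlinarith [log_162_lt_six]

/-- **Row N1, N10's sufficient rate threshold, holds at the term constants of the family**: `2·10⁴ ≤ κ` (the hypothesis shape of
`thresholds_of_kappa_ge`; its residual `κ₁ ≥ 16κ + 1` is N10's own letter). [cite: Balaban1987RG1, (1.18) p.263; Balaban1988RG2Cluster, (1.26) p.8 (bookkeeping numeral)] -/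
theorem kp_n10_lfConstsOfFamily : (2 * 10 ^ 4 : ℝ) ≤ lfConstsOfFamily.κ := by
  rw [lfConstsOfFamily_κ]
  norm_num

/-- **def-R's Stage-7 numerics OF THE FAMILY at the small-field threshold `ε₀`** — an ARGUMENT, not a numeral (row N2: the Record13 pen and seat K0e state the
inequality `ε₀` must meet and its consumer decl before a value is pinned, director-ym LINE №126); every other letter the displayed default of
`numerics7OfRecord₁₂` (`M₁ = M₂ = r = p₀ := 1`, `A₀ := 1`, `log σ₀ := 0`, `εreg := 1`). [cite: Balaban1987RG1, Thm 1 p.255 and p.259; Balaban1988Convergent, (2.4)–(2.5) p.255, (2.13) p.256 (bookkeeping witness)] -/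
def numerics7OfFamily (ε₀ : ℝ) : Stage7Numerics :=
  { numerics7OfRecord₁₂ with ε₀ := ε₀ }

/-- The threshold letter (`rfl`). [cite: Balaban1987RG1, p.259 (bookkeeping)] -/
theorem numerics7OfFamily_ε₀ (ε₀ : ℝ) : (numerics7OfFamily ε₀).ε₀ = ε₀ := rfl

/-- At the old default the numerics of the family ARE the numerics of record: `numerics7OfFamily 1 = numerics7OfRecord₁₂` (`rfl`).
[cite: Balaban1988Convergent, (2.4) p.255 (bookkeeping)] -/
theorem numerics7OfFamily_one : numerics7OfFamily 1 = numerics7OfRecord₁₂ := rfl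

/-- **THE NUMERICS OF THE FAMILY of the Stage-12 witness at threshold `ε₀`**: `ν := numerics7OfFamily ε₀`, `εbg := 1`, `γ := 1∕2`, `τ9 := towerNumericsOfRecord₁₂`,
`A₁ := 1`, `s2 := sect2NumericsOfFamily` (κ re-pinned). [cite: Balaban1988Convergent, (2.4) p.255, (2.10) p.256, (2.28) p.259, (3.4) p.265; Balaban1987RG1, (0.21) p.256 (bookkeeping witness)] -/
def stage12NumericsOfFamily (ε₀ : ℝ) : Stage12Numerics :=
  { stage12NumericsOfRecord with ν := numerics7OfFamily ε₀, s2 := sect2NumericsOfFamily }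

/-- The family numerics' Stage-7 part (`rfl`). [cite: Balaban1988Convergent, (2.4) p.255 (bookkeeping)] -/
theorem stage12NumericsOfFamily_ν (ε₀ : ℝ) : (stage12NumericsOfFamily ε₀).ν = numerics7OfFamily ε₀ := rfl

/-- The family numerics' §2 part (`rfl`). [cite: Balaban1988Convergent, (2.28) p.259 (bookkeeping)] -/
theorem stage12NumericsOfFamily_s2 (ε₀ : ℝ) : (stage12NumericsOfFamily ε₀).s2 = sect2NumericsOfFamily := rfl

/-- **The numerics of the family meet every sign window** (`Stage12Numerics.Pos`) at any positive threshold. [cite: Balaban1988Convergent, (2.4) p.255, (2.10) p.256, (2.28) p.259, (2.34)–(2.39) p.261; Balaban1987RG1, (0.21) p.256 (bookkeeping)] -/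
theorem stage12NumericsOfFamily_pos {ε₀ : ℝ} (hε : 0 < ε₀) : (stage12NumericsOfFamily ε₀).Pos := by
  refine ⟨⟨hε, ?_, ?_, ?_, ?_⟩, ?_, ⟨?_, ?_⟩, ?_, ?_, sect2NumericsOfFamily_pos, ?_, ?_, ?_⟩ <;>
    norm_num [stage12NumericsOfFamily, stage12NumericsOfRecord, numerics7OfFamily, numerics7OfRecord₁₂, towerNumericsOfRecord₁₂,
      sect2NumericsOfFamily, sect2NumericsOfRecord₁₂, lfConstsOfFamily, lfConstsOfRecord₁₂]

/-- **THE FAR-FIELD CANDIDATE FOR `ε₀`, READING THE FAMILY**: `eps0Far L N := 1 ∕ (32·N·(L² + 1))` — small enough for seat K0e's far-field guard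
`9L²ε₀ < min(1∕3, π∕N)` of the tree's crude [B7] Prop. 1 on every torus of a family with block size `L` (print: «ε₀ sufficiently small», depending on `d, L, N`).
OFFERED, not pinned (row N2). [cite: Balaban1987RG1, Thm 1 p.255 and p.259; Balaban1985Averaging, Prop. 1 p.26 (bookkeeping witness)] -/
def eps0Far (L N : ℕ) : ℝ :=
  1 / (32 * (N : ℝ) * ((L : ℝ) ^ 2 + 1))

/-- The candidate is positive at `N ≥ 1`. [cite: Balaban1987RG1, p.259 (bookkeeping)] -/
theorem eps0Far_pos (L N : ℕ) [NeZero N] : 0 < eps0Far L N := by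
  have hN : (0 : ℝ) < N := Nat.cast_pos.mpr (Nat.pos_of_ne_zero (NeZero.ne N))
  unfold eps0Far
  exact div_pos one_pos (mul_pos (mul_pos (by norm_num) hN) (by positivity))

section FarGuardFamily

variable (F : T4Family) (N : ℕ) [NeZero N]

/-- **★ THE FAR-FIELD GUARD HOLDS AT EVERY THRESHOLD UP TO THE CANDIDATE, on every torus of the family, every `N ≥ 1`**: at `d = 4`, `(F.P K).L = F.L` the guard
reads `9·F.L²·ε₀ < min(1∕3, π∕N)`, and for `0 ≤ ε₀ ≤ eps0Far F.L N`: `9L²ε₀ ≤ 9L²∕(32N(L²+1)) < 9∕(32N) ≤ 9∕32 < 1∕3`, `9∕(32N) < π∕N`.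
[cite: Balaban1985Averaging, Prop. 1 p.26; Balaban1987RG1, Thm 1 p.255 and p.259] -/
theorem farGuard_numerics7OfFamily_of_le {ε₀ : ℝ} (h0 : 0 ≤ ε₀) (hle : ε₀ ≤ eps0Far F.L N) (K : ℕ) :
    FarGuard N (numerics7OfFamily ε₀) (F.P K) := by
  have hN : (0 : ℝ) < N := Nat.cast_pos.mpr (Nat.pos_of_ne_zero (NeZero.ne N))
  have hN1 : (1 : ℝ) ≤ N := Nat.one_le_cast.mpr (NeZero.one_le)
  have hL : (0 : ℝ) < (F.L : ℝ) ^ 2 + 1 := by positivity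
  refine ⟨h0, ?_⟩
  rw [T4Family.P_d, T4Family.P_L, numerics7OfFamily_ε₀]
  unfold deltaSU
  rw [Fintype.card_fin]
  have hmono : (((4 + 2) * F.L : ℕ) : ℝ) ^ 2 / 4 * ε₀ ≤ (((4 + 2) * F.L : ℕ) : ℝ) ^ 2 / 4 * eps0Far F.L N :=
    mul_le_mul_of_nonneg_left hle (by positivity)
  have e : (((4 + 2) * F.L : ℕ) : ℝ) ^ 2 / 4 * eps0Far F.L N = 9 / (32 * (N : ℝ)) * ((F.L : ℝ) ^ 2 / ((F.L : ℝ) ^ 2 + 1)) := by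
    unfold eps0Far
    push_cast
    field_simp
    ring
  have h1 : (F.L : ℝ) ^ 2 / ((F.L : ℝ) ^ 2 + 1) < 1 := by
    rw [div_lt_one hL]
    exact lt_add_one _
  have h2 : (((4 + 2) * F.L : ℕ) : ℝ) ^ 2 / 4 * ε₀ < 9 / (32 * (N : ℝ)) := by
    refine hmono.trans_lt ?_
    rw [e]
    exact mul_lt_of_lt_one_right (by positivity) h1
  refine lt_min (h2.trans_le ?_) (h2.trans ?_)
  · rw [div_le_div_iff₀ (by positivity) (by norm_num)]
    nlinarith
  · rw [div_lt_div_iff₀ (by positivity) hN]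
    nlinarith [Real.pi_gt_three]

/-- **The far-field guard holds AT the candidate** `ε₀ := eps0Far F.L N`. [cite: Balaban1985Averaging, Prop. 1 p.26; Balaban1987RG1, p.259] -/
theorem farGuard_numerics7OfFamily_eps0Far (K : ℕ) : FarGuard N (numerics7OfFamily (eps0Far F.L N)) (F.P K) :=
  farGuard_numerics7OfFamily_of_le F N (eps0Far_pos F.L N).le le_rfl K

omit [NeZero N] in
/-- **★ LOCATED-L (kernel form): NO CLOSED THRESHOLD MEETS THE FAR-FIELD GUARD FOR EVERY FAMILY** — for every `ε₀ > 0` there is a family (block size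
`L = 2n + 13` with `n > 1∕(27ε₀)`, torus exponent `1`) on every torus of which the guard FAILS: `9L²ε₀ ≥ 9nε₀ > 1∕3 ≥ min(1∕3, π∕N)`.  So a surviving consumer of
the guard forces the witness numerics to READ THE FAMILY (print's `ε₀` depends on `d, L, N`). [cite: Balaban1987RG1, (0.1) p.251 («L is an odd, positive integer > 11»), Thm 1 p.255; Balaban1985Averaging, Prop. 1 p.26] -/
theorem exists_family_not_farGuard {ε₀ : ℝ} (hε : 0 < ε₀) : ∃ F : T4Family, ∀ K, ¬ FarGuard N (numerics7OfFamily ε₀) (F.P K) := by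
  obtain ⟨n, hn⟩ := exists_nat_gt (1 / (27 * ε₀))
  refine ⟨⟨2 * n + 13, ⟨⟨n + 6, by ring⟩, by omega⟩, by omega, 1, le_rfl⟩, fun K h => ?_⟩
  obtain ⟨-, hlt⟩ := h
  rw [T4Family.P_d, T4Family.P_L, numerics7OfFamily_ε₀] at hlt
  have h13 : min (1 / 3 : ℝ) (Real.pi / Fintype.card (Fin N)) ≤ 1 / 3 := min_le_left _ _
  have hlt' : (((4 + 2) * (2 * n + 13) : ℕ) : ℝ) ^ 2 / 4 * ε₀ < 1 / 3 := lt_of_lt_of_le hlt h13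
  have hn' : 1 < 27 * ε₀ * n := by
    have := (div_lt_iff₀ (by positivity : (0 : ℝ) < 27 * ε₀)).1 hn
    linarith
  have hn0 : (0 : ℝ) ≤ n := Nat.cast_nonneg n
  push_cast at hlt'
  nlinarith [hlt', hn', hn0, hε, mul_nonneg hn0 hε.le, mul_nonneg (mul_nonneg hn0 hn0) hε.le]

end FarGuardFamily

/-! ## §2. The re-pinned witness `θ₀ᶠᵃᵐ(ε₀) = theta12OfFamily F N ε₀ ζ Rz Zt` and its live re-pin `θ₀ᶠᵃᵐ,ˡⁱᵛᵉ(ε₀) = theta12LiveOfFamily F N ε₀ ζ Rz Zt` -/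

section Theta

variable (F : T4Family) (N : ℕ) [NeZero N] (ε₀ : ℝ)
variable (ζ : ZetaOfRecord F N (numerics7OfFamily ε₀) 1) (Rz : (K : ℕ) → Sect2.Residual (F.P K) (MatA N)) (Zt : (K : ℕ) → TkResidualW F N (FluctV N) K)

/-- **THE RE-PINNED STAGE-12 WITNESS OF THE FAMILY at threshold `ε₀`** `θ₀ᶠᵃᵐ(ε₀)`: `Record12Numerics`' maker at the numerics OF THE FAMILY
`stage12NumericsOfFamily ε₀` (κ re-pinned; `ε₀` the open letter of row N2 — instantiate at the value the Record13 pen names, possibly reading `F`), the degenerate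
Stage-5 residual, the identity `p–p′` selector, and the three residual objects `ζ`, `Rz`, `Zt` as ARGUMENTS (K0b's residuals of record plug in by name).
[cite: Balaban1987RG1, (0.21) p.256, (1.12)–(1.16) p.262, (1.20)–(1.21) p.264 and p.259; Balaban1988Convergent, (2.4) p.255, (2.10) p.256, (2.21) p.258, (2.28) p.259, (3.4) p.265, (3.16) p.268; Balaban1989LargeFieldI, (0.3) p.176, (2.1) p.182 (parameter dictionary; bookkeeping witness)] -/
def theta12OfFamily : Stage12Params F N :=
  stage12OfNumerics F N (stage12NumericsOfFamily ε₀) (residual5OfRecord₁₂ F N) ζ Rz Zt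

/-- `θ₀ᶠᵃᵐ(ε₀).ν = numerics7OfFamily ε₀` (`rfl`). [cite: Balaban1988Convergent, (2.4) p.255 (bookkeeping)] -/
theorem theta12OfFamily_ν : (theta12OfFamily F N ε₀ ζ Rz Zt).ν = numerics7OfFamily ε₀ := rfl

/-- `θ₀ᶠᵃᵐ(ε₀).ν.ε₀ = ε₀` (`rfl`). [cite: Balaban1987RG1, p.259 (bookkeeping)] -/
theorem theta12OfFamily_ε₀ : (theta12OfFamily F N ε₀ ζ Rz Zt).ν.ε₀ = ε₀ := rfl

/-- `θ₀ᶠᵃᵐ(ε₀).γ = 1∕2` (`rfl`). [cite: Balaban1987RG1, Thm 1 p.255 (bookkeeping)] -/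
theorem theta12OfFamily_γ : (theta12OfFamily F N ε₀ ζ Rz Zt).γ = 1 / 2 := rfl

/-- `θ₀ᶠᵃᵐ(ε₀).A₁ = 1` (`rfl`). [cite: Balaban1987RG1, (1.16) p.262 (bookkeeping)] -/
theorem theta12OfFamily_A₁ : (theta12OfFamily F N ε₀ ζ Rz Zt).A₁ = 1 := rfl

/-- `θ₀ᶠᵃᵐ(ε₀).τ9.M = 1` (`rfl`). [cite: Balaban1989LargeFieldI, (2.1) p.182 (bookkeeping)] -/
theorem theta12OfFamily_τ9_M : (theta12OfFamily F N ε₀ ζ Rz Zt).τ9.M = 1 := rfl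

/-- `θ₀ᶠᵃᵐ(ε₀).s2 = sect2NumericsOfFamily` (`rfl`). [cite: Balaban1988Convergent, (2.34)–(2.39) p.261 (bookkeeping)] -/
theorem theta12OfFamily_s2 : (theta12OfFamily F N ε₀ ζ Rz Zt).s2 = sect2NumericsOfFamily := rfl

/-- `θ₀ᶠᵃᵐ(ε₀).s2.lf.κ = 2·10⁴` (`rfl`). [cite: Balaban1987RG1, (1.18) p.263 (bookkeeping)] -/
theorem theta12OfFamily_κ : (theta12OfFamily F N ε₀ ζ Rz Zt).s2.lf.κ = 20000 := rfl

/-- `θ₀ᶠᵃᵐ(ε₀).ℓ₆ = 2` (the Stage-1∕3 dictionary's, `rfl`). [cite: Balaban1984PropagatorsII, (2.16) p.225 (bookkeeping)] -/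
theorem theta12OfFamily_ℓ₆ : (theta12OfFamily F N ε₀ ζ Rz Zt).ℓ₆ = 2 := rfl

/-- The term constants of record at `θ₀ᶠᵃᵐ(ε₀)` (`rfl`). [cite: Balaban1988Convergent, (2.28) p.259 (bookkeeping)] -/
theorem lfOfRecord₁₂_theta12OfFamily : lfOfRecord₁₂ F N (theta12OfFamily F N ε₀ ζ Rz Zt) = { lfConstsOfFamily with γ := 1 / 2 } := rfl

/-- `θ₀ᶠᵃᵐ(ε₀)` keeps `ζ` (`rfl`). [cite: Balaban1988Convergent, (3.16) p.268 (bookkeeping)] -/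
theorem theta12OfFamily_ζ : (theta12OfFamily F N ε₀ ζ Rz Zt).ζ = ζ := rfl

/-- `θ₀ᶠᵃᵐ(ε₀)`'s selector is the identity selector (`rfl`). [cite: Balaban1989LargeFieldI, (0.3) p.176 (bookkeeping)] -/
theorem theta12OfFamily_ppSel : (theta12OfFamily F N ε₀ ζ Rz Zt).ppSel = ppSelIdOfRecord F (numerics7OfFamily ε₀) 1 := rfl

/-- `θ₀ᶠᵃᵐ(ε₀)` keeps `Rz` (`rfl`). [cite: Balaban1988Convergent, (2.21) p.258 (bookkeeping)] -/
theorem theta12OfFamily_Rz : (theta12OfFamily F N ε₀ ζ Rz Zt).Rz = Rz := rfl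

/-- `θ₀ᶠᵃᵐ(ε₀)` keeps `Zt` (`rfl`). [cite: Balaban1988Convergent, (3.20) p.269 (bookkeeping)] -/
theorem theta12OfFamily_Zt : (theta12OfFamily F N ε₀ ζ Rz Zt).Zt = Zt := rfl

variable {ε₀} in
/-- **`θ₀ᶠᵃᵐ(ε₀)` IS ADMISSIBLE at every positive threshold — for every family, every `N ≥ 1`, every choice of the residual objects**
(`admissible_stage12OfNumerics` at `stage12NumericsOfFamily_pos`). [cite: Balaban1987RG1, (0.21) p.256, (1.12) p.262, (1.20)–(1.21) p.264; Balaban1988Convergent, (2.10) p.256, (2.28) p.259, (2.34)–(2.39) p.261, (3.4) p.265 (bookkeeping witness)] -/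
theorem admissible_theta12OfFamily (hε : 0 < ε₀) : (theta12OfFamily F N ε₀ ζ Rz Zt).Admissible F N :=
  admissible_stage12OfNumerics F N (stage12NumericsOfFamily ε₀) (residual5OfRecord₁₂ F N) ζ Rz Zt (stage12NumericsOfFamily_pos hε)

/-- **AT K0b's RESIDUALS OF RECORD `θ₀ᶠᵃᵐ(ε₀)` CARRIES THEM** (`⟨rfl, rfl, rfl⟩`; K0b's (3.16) factor is generic in the Stage-7 numerics) — the `hres` input of
seat K0c's generic four-row reductions (`Stage12Params.provisos₁₀_of_localBg_anySel`, `…record12Inhabited_body15_liveRepin_of`,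
`Node00/Record12MeasurabilityAtLiveRecord`), which thereby apply to the witness of the family BY NAME.
[cite: Balaban1988Convergent, (3.16) p.268, (2.21) p.258, (3.20) p.269 (bookkeeping)] -/
theorem hasResidualsOfRecord_theta12OfFamily :
    (theta12OfFamily F N ε₀ (zeta316OfRecord F N (numerics7OfFamily ε₀) 1 1) (RzOfRecord F N) (ZtOfRecord F N)).HasResidualsOfRecord F N :=
  ⟨rfl, rfl, rfl⟩

/-- **Row N1 AT `θ₀ᶠᵃᵐ(ε₀)` — the (D4) `tree` numeral**: `128·log 162 ≤ θ₀ᶠᵃᵐ.s2.lf.κ` (the hypothesis shape of `kappa_lower_of_condsL_c13OfRecord₁₂`).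
[cite: Balaban1987RG1, (0.25)–(0.26) p.257; Balaban1988RG2Cluster, (1.26) p.8] -/
theorem kp_tree_theta12OfFamily : 128 * Real.log 162 ≤ (theta12OfFamily F N ε₀ ζ Rz Zt).s2.lf.κ :=
  kp_tree_lfConstsOfFamily

/-- **Row N1 AT `θ₀ᶠᵃᵐ(ε₀)` — the (D4) `large` numeral** (the right-hand side of `condsL_large_c13OfRecord₁₂_half_iff`):
`10·(64·log 162 + 1) ≤ (½(θ₀ᶠᵃᵐ.ℓ₆+1) − 1)·θ₀ᶠᵃᵐ.s2.lf.κ`. [cite: Balaban1987RG1, (0.25)–(0.26) p.257; Balaban1988RG2Cluster, p.21 (after (2.39))] -/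
theorem kp_large_theta12OfFamily :
    10 * (64 * Real.log 162 + 1) ≤
      (((((theta12OfFamily F N ε₀ ζ Rz Zt).ℓ₆ + 1 : ℕ) : ℝ)) / 2 - 1) * (theta12OfFamily F N ε₀ ζ Rz Zt).s2.lf.κ :=
  kp_large_lfConstsOfFamily

/-- **Row N1 AT `θ₀ᶠᵃᵐ(ε₀)` — N10's rate threshold** `2·10⁴ ≤ θ₀ᶠᵃᵐ.s2.lf.κ`. [cite: Balaban1987RG1, (1.18) p.263 (bookkeeping numeral)] -/
theorem kp_n10_theta12OfFamily : (2 * 10 ^ 4 : ℝ) ≤ (theta12OfFamily F N ε₀ ζ Rz Zt).s2.lf.κ :=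
  kp_n10_lfConstsOfFamily

variable {ε₀} in
/-- **The far-field guard holds AT `θ₀ᶠᵃᵐ(ε₀)` on every torus of the family whenever `0 ≤ ε₀ ≤ eps0Far F.L N`.** [cite: Balaban1985Averaging, Prop. 1 p.26; Balaban1987RG1, p.259] -/
theorem farGuard_theta12OfFamily_of_le (h0 : 0 ≤ ε₀) (hle : ε₀ ≤ eps0Far F.L N) : ∀ K, FarGuard N (theta12OfFamily F N ε₀ ζ Rz Zt).ν (F.P K) :=
  fun K => farGuard_numerics7OfFamily_of_le F N h0 hle K

variable {ε₀} in
/-- **P7's EVERYWHERE form AT `θ₀ᶠᵃᵐ(ε₀)` = print's on-domain proviso ∧ the annulus proviso, whenever `0 ≤ ε₀ ≤ eps0Far F.L N`** — seat K0e's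
`hasContTransportAlong_iff_dom_and_annulus`, applicable at such thresholds (at the closed default `ε₀ = 1` it was not).  Informational for the successor record,
which re-points P7 to an on-domain field. [cite: Balaban1987RG1, (0.13) p.254, (0.17)–(0.19) p.255 and p.259; Balaban1985Averaging, Prop. 1 p.26] -/
theorem contT_theta12OfFamily_iff_dom_and_annulus (h0 : 0 ≤ ε₀) (hle : ε₀ ≤ eps0Far F.L N) :
    (theta12OfFamily F N ε₀ ζ Rz Zt).toStage8Params.HasContTransportAlong ↔
      (theta12OfFamily F N ε₀ ζ Rz Zt).toStage8Params.HasContTransportAlongDom F N (TcOfRecord F N) ∧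
        (theta12OfFamily F N ε₀ ζ Rz Zt).toStage8Params.HasContTransportAlongAnnulus F N (TcOfRecord F N) :=
  hasContTransportAlong_iff_dom_and_annulus (farGuard_theta12OfFamily_of_le F N ζ Rz Zt h0 hle)

/-- **THE LIVE RE-PIN OF THE WITNESS OF THE FAMILY** `θ₀ᶠᵃᵐ,ˡⁱᵛᵉ(ε₀) := θ₀ᶠᵃᵐ(ε₀).liveRepin` (director-ym LINE №114 (α): the `p–p′` selector re-pinned to the live
selector of record; every numeral, `ζ`, `Rz`, `Zt` unchanged). [cite: Balaban1989LargeFieldI, (0.3) p.176 and p.177; Balaban1988Convergent, (3.22) p.269 (bookkeeping witness)] -/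
def theta12LiveOfFamily : Stage12Params F N :=
  (theta12OfFamily F N ε₀ ζ Rz Zt).liveRepin F N

/-- `θ₀ᶠᵃᵐ,ˡⁱᵛᵉ(ε₀)` IS the live re-pin of `θ₀ᶠᵃᵐ(ε₀)` (`rfl`). [cite: Balaban1989LargeFieldI, (0.3) p.176 (bookkeeping)] -/
theorem theta12LiveOfFamily_eq : theta12LiveOfFamily F N ε₀ ζ Rz Zt = (theta12OfFamily F N ε₀ ζ Rz Zt).liveRepin F N := rfl

/-- `θ₀ᶠᵃᵐ,ˡⁱᵛᵉ(ε₀).ν = numerics7OfFamily ε₀` (`rfl`). [cite: Balaban1988Convergent, (2.4) p.255 (bookkeeping)] -/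
theorem theta12LiveOfFamily_ν : (theta12LiveOfFamily F N ε₀ ζ Rz Zt).ν = numerics7OfFamily ε₀ := rfl

/-- `θ₀ᶠᵃᵐ,ˡⁱᵛᵉ(ε₀).γ = 1∕2` (`rfl`). [cite: Balaban1987RG1, Thm 1 p.255 (bookkeeping)] -/
theorem theta12LiveOfFamily_γ : (theta12LiveOfFamily F N ε₀ ζ Rz Zt).γ = 1 / 2 := rfl

/-- `θ₀ᶠᵃᵐ,ˡⁱᵛᵉ(ε₀).A₁ = 1` (`rfl`). [cite: Balaban1987RG1, (1.16) p.262 (bookkeeping)] -/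
theorem theta12LiveOfFamily_A₁ : (theta12LiveOfFamily F N ε₀ ζ Rz Zt).A₁ = 1 := rfl

/-- `θ₀ᶠᵃᵐ,ˡⁱᵛᵉ(ε₀).s2 = sect2NumericsOfFamily` (`rfl`). [cite: Balaban1988Convergent, (2.34)–(2.39) p.261 (bookkeeping)] -/
theorem theta12LiveOfFamily_s2 : (theta12LiveOfFamily F N ε₀ ζ Rz Zt).s2 = sect2NumericsOfFamily := rfl

/-- `θ₀ᶠᵃᵐ,ˡⁱᵛᵉ(ε₀)`'s selector IS the live selector of record at the family witness's numerics, normalisations and weights (`rfl`). [cite: Balaban1989LargeFieldI, (0.3) p.176 (bookkeeping)] -/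
theorem theta12LiveOfFamily_ppSel :
    (theta12LiveOfFamily F N ε₀ ζ Rz Zt).ppSel =
      ppSelLiveOfRecord F N (numerics7OfFamily ε₀) towerNumericsOfRecord₁₂ (EOfRecord₁₀ F N (theta12OfFamily F N ε₀ ζ Rz Zt).toStage9Params)
        (wOfRecord₉ F N (theta12OfFamily F N ε₀ ζ Rz Zt).toStage9Params) := rfl

variable {ε₀} in
/-- **`θ₀ᶠᵃᵐ,ˡⁱᵛᵉ(ε₀)` IS ADMISSIBLE at every positive threshold** (`Admissible` is selector-blind). [cite: Balaban1987RG1, (0.21) p.256, (1.12) p.262, (1.20)–(1.21) p.264; Balaban1988Convergent, (2.10) p.256, (2.34)–(2.39) p.261, (3.4) p.265 (bookkeeping witness)] -/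
theorem admissible_theta12LiveOfFamily (hε : 0 < ε₀) : (theta12LiveOfFamily F N ε₀ ζ Rz Zt).Admissible F N :=
  (admissible_theta12OfFamily F N ζ Rz Zt hε).liveRepin

/-- Row N1's `tree` numeral at `θ₀ᶠᵃᵐ,ˡⁱᵛᵉ(ε₀)`. [cite: Balaban1987RG1, (0.25)–(0.26) p.257; Balaban1988RG2Cluster, (1.26) p.8] -/
theorem kp_tree_theta12LiveOfFamily : 128 * Real.log 162 ≤ (theta12LiveOfFamily F N ε₀ ζ Rz Zt).s2.lf.κ :=
  kp_tree_lfConstsOfFamily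

/-- Row N1's `large` numeral at `θ₀ᶠᵃᵐ,ˡⁱᵛᵉ(ε₀)`. [cite: Balaban1987RG1, (0.25)–(0.26) p.257; Balaban1988RG2Cluster, p.21 (after (2.39))] -/
theorem kp_large_theta12LiveOfFamily :
    10 * (64 * Real.log 162 + 1) ≤
      (((((theta12LiveOfFamily F N ε₀ ζ Rz Zt).ℓ₆ + 1 : ℕ) : ℝ)) / 2 - 1) * (theta12LiveOfFamily F N ε₀ ζ Rz Zt).s2.lf.κ :=
  kp_large_lfConstsOfFamily

variable {ε₀} in
/-- The far-field guard at `θ₀ᶠᵃᵐ,ˡⁱᵛᵉ(ε₀)` whenever `0 ≤ ε₀ ≤ eps0Far F.L N` (same numerics). [cite: Balaban1985Averaging, Prop. 1 p.26; Balaban1987RG1, p.259] -/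
theorem farGuard_theta12LiveOfFamily_of_le (h0 : 0 ≤ ε₀) (hle : ε₀ ≤ eps0Far F.L N) :
    ∀ K, FarGuard N (theta12LiveOfFamily F N ε₀ ζ Rz Zt).ν (F.P K) :=
  farGuard_theta12OfFamily_of_le F N ζ Rz Zt h0 hle

/-- **★ `SlotsNondegenerate` AT `θ₀ᶠᵃᵐ,ˡⁱᵛᵉ(ε₀)` from `Provisos₁₀` of its Stage-9 tuple alone** (`Record12LiveSelectorTorus`'s generic `slotsNondegenerate_liveRepin`).
[cite: Balaban1988Convergent, (3.22) p.269, (3.24) p.270; Balaban1989LargeFieldI, (0.3)–(0.4) p.176] -/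
theorem slotsNondegenerate_theta12LiveOfFamily (hP : (theta12LiveOfFamily F N ε₀ ζ Rz Zt).toStage9Params.Provisos₁₀) :
    (theta12LiveOfFamily F N ε₀ ζ Rz Zt).SlotsNondegenerate :=
  Stage12Params.slotsNondegenerate_liveRepin F N (theta12OfFamily F N ε₀ ζ Rz Zt) hP

variable {ε₀} in
/-- **RUNG A (skeleton v3) AT `θ₀ᶠᵃᵐ,ˡⁱᵛᵉ(ε₀)`, read at its Stage-9 tuple, from `0 < ε₀` and `Provisos₁₀` there alone** (`Record12LiveSelectorTorus` §4
`Stage12Params.rungA_liveRepin`). [cite: Balaban1988Convergent, (3.4) p.265, (3.22) p.269, (3.24) p.270; Balaban1989LargeFieldI, (0.3)–(0.4) p.176 (bookkeeping)] -/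
theorem rungA_theta12LiveOfFamily (hε : 0 < ε₀) (hP : (theta12LiveOfFamily F N ε₀ ζ Rz Zt).toStage9Params.Provisos₁₀) :
    (theta12LiveOfFamily F N ε₀ ζ Rz Zt).toStage9Params.Admissible ∧ (theta12LiveOfFamily F N ε₀ ζ Rz Zt).toStage9Params.Provisos₁₀ ∧
      (theta12LiveOfFamily F N ε₀ ζ Rz Zt).toStage9Params.γ < 1 ∧ 0 < (theta12LiveOfFamily F N ε₀ ζ Rz Zt).toStage9Params.A₁ ∧
        ∀ θ₁ : Stage12Params F N, θ₁.toStage9Params = (theta12LiveOfFamily F N ε₀ ζ Rz Zt).toStage9Params → θ₁.SlotsNondegenerate :=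
  Stage12Params.rungA_liveRepin F N (theta12OfFamily F N ε₀ ζ Rz Zt) (admissible_theta12OfFamily F N ζ Rz Zt hε) hP

/-- **AT K0b's RESIDUALS OF RECORD `θ₀ᶠᵃᵐ,ˡⁱᵛᵉ(ε₀)` CARRIES THEM** (`⟨rfl, rfl, rfl⟩`). [cite: Balaban1988Convergent, (3.16) p.268, (2.21) p.258, (3.20) p.269 (bookkeeping)] -/
theorem hasResidualsOfRecord_theta12LiveOfFamily :
    (theta12LiveOfFamily F N ε₀ (zeta316OfRecord F N (numerics7OfFamily ε₀) 1 1) (RzOfRecord F N) (ZtOfRecord F N)).HasResidualsOfRecord F N :=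
  ⟨rfl, rfl, rfl⟩

/-- **… hence print's partition of unity `ZtUnity` holds at it** (K0b, by name). [cite: Balaban1988Convergent, (3.16)–(3.20) pp.268–269] -/
theorem ztUnity_theta12LiveOfFamily :
    (theta12LiveOfFamily F N ε₀ (zeta316OfRecord F N (numerics7OfFamily ε₀) 1 1) (RzOfRecord F N) (ZtOfRecord F N)).ZtUnity F N :=
  (hasResidualsOfRecord_theta12LiveOfFamily F N ε₀).ztUnity

/-- **★ THE K0′ BODY FOR `F` AT `N = 2` FROM THE WITNESS OF THE FAMILY ⟸ `0 < ε₀` and `Provisos₁₂` AT IT, ALONE** — the text of `Record12Inhabited` (rev 15) for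
one family, VERBATIM; `ZtUnity`, `SlotsNondegenerate` (from `.base`) and `Admissible` are theorems there.  NOT a discharge: `h` is the open rows (H-U) ∕ P6 ∕ P7
∕ P11 read at `θ₀ᶠᵃᵐ,ˡⁱᵛᵉ(ε₀)`. [cite: Balaban1988Convergent, Thm 1 p.262, (3.16)–(3.22) pp.268–269; Balaban1989LargeFieldI, (0.3)–(0.4) p.176 (bookkeeping)] -/
theorem exists_k0prime_of_theta12LiveOfFamily_of_provisos₁₂ (F : T4Family) {ε₀ : ℝ} (hε : 0 < ε₀)
    (h : (theta12LiveOfFamily F 2 ε₀ (zeta316OfRecord F 2 (numerics7OfFamily ε₀) 1 1) (RzOfRecord F 2) (ZtOfRecord F 2)).Provisos₁₂ F 2) :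
    ∃ θ : Stage12Params F 2, θ.Provisos₁₂ F 2 ∧ (θ.ZtUnity F 2 ∧ θ.SlotsNondegenerate) ∧ θ.Admissible F 2 :=
  ⟨_, h, ⟨ztUnity_theta12LiveOfFamily F 2 ε₀, slotsNondegenerate_theta12LiveOfFamily F 2 ε₀ _ _ _ h.base⟩,
    admissible_theta12LiveOfFamily F 2 _ _ _ hε⟩

end Theta

end Literature.MathematicalPhysics.QuantumFieldTheory.Balaban1983to89.Node00

end
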